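import Summits.ResolutionOfSingularities.ResolutionOfSingularities.Theorems.PurelyInseparableDim4DirectrixTwo
import Summits.ResolutionOfSingularities.ResolutionOfSingularities.Theorems.PurelyInseparableDim4IsolationConverse
import HarnessLib

/-!
# F4-I(p,p) — the RIDGE TRICHOTOMY and the JET BUDGET (cell `res-dim4-pi`, seat idea-3; replay file)

[OURS · counted 0 · CANDIDATE statements of this cell typed over the tree's vocabulary, plus two
kernel-checked GLUE theorems; nothing here is a statement of any manuscript and nothing here proves
resolution of singularities in dimension ≥ 4 / characteristic `p`.]

The tree already reads the DIRECTRIX LETTER `ē(s) = dim_K A(in(s.F))` on the frame's cleaned states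
(`Directrix.*`: `ē` antitone along `Step0` chains, `1 ≤ ē ≤ 3`, eventually constant; near points lie on
`P(A)`).  idea-3's census letter `dL` (dimension of the linear space along which the tangent cone is
additive) IS `ē` (for `k < p` the `k`-th polar vanishes once the first does, `k!` being a unit).

This file types the seat's two census laws as named `Prop`s and proves the glue:
* `NarrowDrop p q` — CARD I-3-7 (N1): along a `Step0` edge between isolated states from a state of
  order exactly `q` with `ē = 1`, the Hasse–Jacobian colength `μ⁺ = dim K[x]/(J⁺_q + 𝔪ᴺ)` (read at any
  certificate level `N`, `𝔪ᴺ ≤ J⁺_q + 𝔪ᴺ⁺¹`) DROPS strictly.  Census: 0 exceptions / 18 035 narrow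
  edges at `(p,q) = (3,3)`, 1 127 at `(5,5)`.
* `HeightBudget p q` — CARD I-3-8 (H): an isolated `Step0` chain `c₀ → ⋯ → c_m` has `m + 1 ≤ μ⁺(c₀)`.
  Census: 0 violations / 25 530 complete `𝔽₃`-rational graphs, tight in 47 %.
* `NoWideTrap p q` / `NoAboveFloorTrap p q` — the two residual pieces: no infinite isolated chain all on
  the floor (`ord = q`) with `ē ≥ 2` throughout; none staying above the floor (`ord ≠ q`) forever.
* `noIsolatedTrap_of_heightBudget : HeightBudget p q → NoIsolatedTrap p q` (pigeonhole).
* `noIsolatedTrap_of_trichotomy : NarrowDrop p p → NoWideTrap p p → NoAboveFloorTrap p p →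
  NoIsolatedTrap p p` (`p` prime): an infinite isolated chain is eventually on the floor or never; on
  the floor `ē` stabilises (`Directrix.step0_chain_eventually_constant`); a stable value `≥ 2` is a wide
  trap, the stable value `1` makes `μ⁺` strictly decrease for ever (certificates from
  `IsolationConverse.exists_certificate_of_isIsolated`), which is absurd (`not_strictAnti_of_wellFoundedLT`).
bears_on: LADDER-RESOLUTION:D157-DOOR2 (res-dim4-pi · F4-I(3,3) beyond Milnor-finite).

Typed by seat res-dim4-idea-3 (CARD I-3-9, `HOME/res-dim4-idea-3/lean/RidgeBudget.lean`, sha16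
`f7803d11f8c5b863`); landed by seat res-dim4-p-9 under DR-157-C verbatim, except: this paragraph added and the private copy of
«no strictly decreasing ℕ-sequence» replaced by Mathlib's `not_strictAnti_of_wellFoundedLT` (gate dedup).
Supports stmt-ResolutionOfSingularities-16155 (helper).
-/

set_option linter.dupNamespace false

noncomputable section

namespace Summit.ResolutionOfSingularities.ResolutionOfSingularities.Theorems.PIDim4

namespace RidgeBudget

open MvPolynomial Finset
open Literature.AlgebraicGeometry.Resolution
open Literature.AlgebraicGeometry.Resolution.Hauser2010
open Literature.AlgebraicGeometry.Resolution.HauserPerlega2019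
open Literature.Barriers.ResolutionOfSingularities
open PointBlowup (gradSpan additiveSubspace)

variable {K : Type} [Field K]

/-! ## 1. The objects -/

/-- The **jet colength** `dim_K K[x] ⧸ (J⁺_q(F) + 𝔪₀ᴺ)` (finite for every `N`). [OURS · definition] -/
def jetColength (q N : ℕ) (F : MvPolynomial (Fin 4) K) : ℕ :=
  Module.finrank K (MvPolynomial (Fin 4) K ⧸ (singLocusIdeal q F ⊔ originIdeal K ^ N))

/-- An **isolation certificate at level `N`**: `𝔪₀ᴺ ≤ J⁺_q(F) + 𝔪₀ᴺ⁺¹` (then `jetColength q N F` is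
the local colength `μ⁺(F)` of `J⁺_q(F)` at the origin, the same for every larger `N`). [OURS · definition] -/
def IsCert (q N : ℕ) (F : MvPolynomial (Fin 4) K) : Prop :=
  originIdeal K ^ N ≤ singLocusIdeal q F ⊔ originIdeal K ^ (N + 1)

/-- The **directrix letter** `ē(F) = dim_K A(in F)` of the tree (`Directrix.*`), as a number.
[cite: CossartJannsenSaito2020, Def. 2.18 and Thm. 3.10 (4)] -/
def ebar (F : MvPolynomial (Fin 4) K) : ℕ :=
  Module.finrank K (additiveSubspace (initialForm F))

/-! ## 2. The candidate statements (census laws of seat idea-3; OPEN) -/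

/-- **(N1) `NarrowDrop p q`** (CARD I-3-7): on a `Step0` edge between isolated `q`-fold states, from a
state of order exactly `q` whose tangent cone has a ONE-dimensional ridge (`ē = 1`), the jet colength
read at certificate levels drops strictly.  OPEN; census 0 / 18 035 at `(3,3)`. [OURS · candidate] -/
def NarrowDrop (p q : ℕ) : Prop :=
  ∀ (K : Type) [Field K] [CharP K p] [DecidableEq K] (s s' : State K) (N N' : ℕ),
    IsIsolated q s.F → IsIsolated q s'.F → Step0 q s s' → ordZero s.F = q → ebar s.F = 1 →
      IsCert q N s.F → IsCert q N' s'.F → jetColength q N' s'.F < jetColength q N s.F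

/-- **(H) `HeightBudget p q`** (CARD I-3-8): an isolated `Step0` chain `c 0 → ⋯ → c m` has
`m + 1 ≤ μ⁺(c 0)` (read at any certificate level).  OPEN; census 0 / 25 530 at `(3,3)`, tight.
[OURS · candidate] -/
def HeightBudget (p q : ℕ) : Prop :=
  ∀ (K : Type) [Field K] [CharP K p] [DecidableEq K] (c : ℕ → State K) (m N : ℕ),
    (∀ k, k ≤ m → IsIsolated q (c k).F) → (∀ k, k < m → Step0 q (c k) (c (k + 1))) →
      IsCert q N (c 0).F → m + 1 ≤ jetColength q N (c 0).F

/-- **`NoWideTrap p q`**: no infinite `Step0` chain of isolated states, all of order exactly `q` with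
ridge dimension `ē ≥ 2`.  OPEN (the residual piece; plateaus of `μ⁺` live here). [OURS · candidate] -/
def NoWideTrap (p q : ℕ) : Prop :=
  ∀ (K : Type) [Field K] [CharP K p] [DecidableEq K],
    ¬ ∃ c : ℕ → State K, ∀ k, IsIsolated q (c k).F ∧ Step0 q (c k) (c (k + 1)) ∧
      ordZero (c k).F = q ∧ 2 ≤ ebar (c k).F

/-- **`NoAboveFloorTrap p q`**: no infinite `Step0` chain of isolated states none of which has order
exactly `q`.  OPEN (census: above-floor isolated runs of length ≤ 3 at `(3,3)`). [OURS · candidate] -/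
def NoAboveFloorTrap (p q : ℕ) : Prop :=
  ∀ (K : Type) [Field K] [CharP K p] [DecidableEq K],
    ¬ ∃ c : ℕ → State K, ∀ k, IsIsolated q (c k).F ∧ Step0 q (c k) (c (k + 1)) ∧ ordZero (c k).F ≠ q

/-! ## 3. Glue -/

/-- **(H) ⇒ F4-I.**  An infinite isolated chain would contain finite chains of every length from
`c 0`, whose certificate exists by `IsolationConverse.exists_certificate_of_isIsolated`.
[OURS · glue] [folklore] -/
theorem noIsolatedTrap_of_heightBudget (p q : ℕ) (hH : HeightBudget p q) : NoIsolatedTrap p q := by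
  intro K _ _ _
  rintro ⟨c, hc⟩
  obtain ⟨N, hN⟩ := IsolationConverse.exists_certificate_of_isIsolated (hc 0).1
  have h := hH K c (jetColength q N (c 0).F) N (fun k _ => (hc k).1) (fun k _ => (hc k).2) hN
  omega

/-- Along an isolated `Step0` chain whose state `c i`, `1 ≤ i`, has order exactly `p`, every later
state has order `p` and `∇(initial form) ≠ 0` (cleaned states: `Directrix.gradSpan_initialForm_ne_bot_of_isClean`,
`Directrix.step0_chain_ordZero_eq`). [OURS · frame reading] [folklore] -/
theorem floor_tail (p : ℕ) [Fact p.Prime] [CharP K p] [DecidableEq K] {c : ℕ → State K}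
    (hc : ∀ k, Step0 p (c k) (c (k + 1))) {i : ℕ} (hi : ordZero (c (i + 1)).F = p) (k : ℕ) :
    ordZero (c (i + 1 + k)).F = p ∧ gradSpan (initialForm (c (i + 1 + k)).F) ≠ ⊥ := by
  have hclean : HauserPerlega.IsClean p (c (i + 1)).F := by
    obtain ⟨-, j, b, -, -, -, -, hck⟩ := hc i
    rw [hck]
    exact Directrix.isClean_step p _ j b (c i)
  have hgrad : gradSpan (initialForm (c (i + 1)).F) ≠ ⊥ :=
    Directrix.gradSpan_initialForm_ne_bot_of_isClean p hi hclean
  have hc' : ∀ k, Step0 p (c (i + 1 + k)) (c (i + 1 + (k + 1))) := fun k => by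
    have := hc (i + 1 + k)
    rwa [show i + 1 + k + 1 = i + 1 + (k + 1) by ring] at this
  exact Directrix.step0_chain_ordZero_eq p (fun k => c (i + 1 + k)) hc' (by simpa using hi)
    (by simpa using hgrad) k

/-- **THE RIDGE TRICHOTOMY.**  `F4-I(p,p)` follows from the three pieces: (N1) narrow edges drop `μ⁺`,
no wide floor trap, no above-floor trap. [OURS · glue] [folklore] -/
theorem noIsolatedTrap_of_trichotomy (p : ℕ) [Fact p.Prime] (hN1 : NarrowDrop p p)
    (hW : NoWideTrap p p) (hA : NoAboveFloorTrap p p) : NoIsolatedTrap p p := by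
  intro K _ _ _
  rintro ⟨c, hc⟩
  -- either some state of index ≥ 1 is on the floor, or the shifted chain stays above it for ever
  by_cases hfloor : ∃ i, ordZero (c (i + 1)).F = p
  swap
  · push Not at hfloor
    exact hA K ⟨fun k => c (k + 1), fun k => ⟨(hc (k + 1)).1, (hc (k + 1)).2, hfloor k⟩⟩
  obtain ⟨i, hi⟩ := hfloor
  -- the floor tail `d k = c (i + 1 + k)`
  set d : ℕ → State K := fun k => c (i + 1 + k) with hd
  have hdstep : ∀ k, Step0 p (d k) (d (k + 1)) := fun k => by
    have := (hc (i + 1 + k)).2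
    simp only [hd]
    rwa [show i + 1 + (k + 1) = i + 1 + k + 1 by ring]
  have hdiso : ∀ k, IsIsolated p (d k).F := fun k => (hc (i + 1 + k)).1
  have hdord : ∀ k, ordZero (d k).F = p := fun k => (floor_tail p (fun k => (hc k).2) hi k).1
  have hdgrad : gradSpan (initialForm (d 0).F) ≠ ⊥ := (floor_tail p (fun k => (hc k).2) hi 0).2
  obtain ⟨M, e, h1, -, hM⟩ := Directrix.step0_chain_eventually_constant p d hdstep (hdord 0) hdgrad
  by_cases he : 2 ≤ e
  · -- a wide trap
    refine hW K ⟨fun k => d (M + k), fun k => ⟨hdiso _, ?_, hdord _, ?_⟩⟩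
    · have := hdstep (M + k)
      rwa [show M + k + 1 = M + (k + 1) by ring] at this
    · show 2 ≤ ebar (d (M + k)).F
      rw [ebar, hM (M + k) (Nat.le_add_right M k)]
      exact he
  · -- the stable value is `1`: `μ⁺` drops for ever
    have he1 : e = 1 := by omega
    have hcert : ∀ k, ∃ N, IsCert p N (d (M + k)).F := fun k =>
      IsolationConverse.exists_certificate_of_isIsolated (hdiso (M + k))
    choose Nk hNk using hcert
    refine not_strictAnti_of_wellFoundedLT (fun k => jetColength p (Nk k) (d (M + k)).F)
      (strictAnti_nat_of_succ_lt fun k => ?_)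
    have hstep : Step0 p (d (M + k)) (d (M + (k + 1))) := by
      have := hdstep (M + k)
      rwa [show M + k + 1 = M + (k + 1) by ring] at this
    have hek : ebar (d (M + k)).F = 1 := by
      rw [ebar, hM (M + k) (Nat.le_add_right M k), he1]
    exact hN1 K (d (M + k)) (d (M + (k + 1))) (Nk k) (Nk (k + 1)) (hdiso _) (hdiso _) hstep
      (hdord _) hek (hNk k) (hNk (k + 1))

/-- Conversely the two residual pieces are special cases of F4-I (sub-chains), so that
`NoIsolatedTrap p p ↔ NoWideTrap p p ∧ NoAboveFloorTrap p p ∧ (no NARROW floor trap)`, and (N1) kills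
the narrow floor traps. [OURS · glue] [folklore] -/
theorem noWideTrap_of_noIsolatedTrap (p q : ℕ) (h : NoIsolatedTrap p q) : NoWideTrap p q := by
  intro K _ _ _
  rintro ⟨c, hc⟩
  exact h K ⟨c, fun k => ⟨(hc k).1, (hc k).2.1⟩⟩

/-- See `noWideTrap_of_noIsolatedTrap`. [OURS · glue] [folklore] -/
theorem noAboveFloorTrap_of_noIsolatedTrap (p q : ℕ) (h : NoIsolatedTrap p q) :
    NoAboveFloorTrap p q := by
  intro K _ _ _
  rintro ⟨c, hc⟩
  exact h K ⟨c, fun k => ⟨(hc k).1, (hc k).2.1⟩⟩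

/-- (H) is at least as strong as each piece; in particular `HeightBudget p p → NoWideTrap p p`, the
only handle this seat has on the wide floor regime. [OURS · glue] [folklore] -/
theorem noWideTrap_of_heightBudget (p q : ℕ) (hH : HeightBudget p q) : NoWideTrap p q :=
  noWideTrap_of_noIsolatedTrap p q (noIsolatedTrap_of_heightBudget p q hH)

end RidgeBudget

end Summit.ResolutionOfSingularities.ResolutionOfSingularities.Theorems.PIDim4

end
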